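import Summits.Ventures.PercRepro.C025ProfileThinNonSimple
import Summits.Ventures.PercRepro.C025ProfileCases

/-!
# THE ROWS `(q, u)` OF THE PROFILE INEQUALITY AT GIRTH `≥ u`, AND C-025 AT `(p, q)` AT GIRTH `≥ p − 1` (night-3 g18)

g6's `profileIneq_of_girth` proves the row `(q, u)` of `(Π)` (C-032) on every finite matroid in which every set of at most
`u` points is independent (girth `≥ u + 1`), by one global count: every rank-`q` set is a `q`-subset of the ground set, its
price is at most `C(n, u)/C(n, q)`, and every `u`-subset of the ground set has rank `u`.  This module lowers the girth by ONE
for the rows with `u ≥ q + 2`: **every set of at most `u − 1` points independent** (girth `≥ u`) suffices.  The price bound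
is unchanged (a rank-`q` set is still a `q`-subset, `q + 1 ≤ u − 1`), and the level count `C(n, u) ≤ #{S : ρ(S) = u}` is
recovered by an injection: a `u`-subset is independent (rank `u`) or a `u`-circuit `C` (rank `u − 1`, every proper subset
independent), and `C ↦ C ∪ {y_C}` with `y_C ∈ E ∖ cl(C)` (exists as soon as `ρ(E) ≥ u`; if `ρ(E) < u` every price is `0`)
is injective into the `(u+1)`-subsets of rank `u`: two distinct `u`-circuits `C, C'` in a common `(u+1)`-set `T` of rank `u`
would give, by submodularity, `2(u − 1) = ρ(C) + ρ(C') ≥ ρ(T) + ρ(C ∩ C') = u + (u − 1)`.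
With g6's bridge (here pointwise in `M`, `rls_of_profileIneq_rows`) this gives **C-025 at `(p, q)` for every `p ≥ q + 3`
on every matroid of girth `≥ p − 1`** (every set with at most `p − 2` points independent) — g6 / Theorem G′ territory was
girth `≥ p`.
* `price_eq_zero_of_eRank_lt`, `profileIneq_of_eRank_lt` — the rows `(q, u)` with `u > ρ(E)` are trivial;
* `price_le_of_card`, `sum_price_le_choose` — the price bound of g6 for a `q`-subset, and `Σ price ≤ C(n, u)`;
* `rkN_eq_of_dep_of_girth`, `exists_notMem_closure_of_rkN_eq`, `rkN_insert_of_notMem_closure`, `eq_of_insert_eq_of_girth`,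
  **`choose_le_card_levelSet_of_girth`** — the injection and the level count;
* **`profileIneq_of_girth_succ`** `(hg : ∀ T ⊆ M.E, T.encard ≤ v → M.Indep T) (hqv : q + 1 ≤ v) : ProfileIneq M q (v + 1)`;
* **`rls_of_profileIneq_rows`**, **`rls_of_girth`**, **`rls_of_girth'`** — C-025 at `(v + 2, q)` for `q + 1 ≤ v` when every
  `v`-subset is independent (equivalently `ThmN.RLS M p q` for `q + 3 ≤ p` at girth `≥ p − 1`).
No `def`, no `instance`, no notation.  Axioms: standard.
-/

open scoped Matroid

namespace PercRepro

open Set Finset ThmH Staged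

namespace GirthRows

variable {α : Type} [DecidableEq α] {M : Matroid α} [M.Finite]

/-- If `ρ(E) < u`, no rank-`q` set is demanding at the level `u`: every price is `0`. -/
theorem price_eq_zero_of_eRank_lt {q u : ℕ} (h : M.eRank < u) (B : Finset α) : Profile.price M q u B = 0 := by
  unfold Profile.price
  rw [if_neg]
  intro hle
  have h1 : M.eRk ((gr M \ B : Finset α) : Set α) ≤ M.eRank := M.eRk_le_eRank _
  exact absurd h (not_lt.2 (hle.trans h1))

/-- The rows `(q, u)` with `u > ρ(E)` hold trivially (left side `0`). -/
theorem profileIneq_of_eRank_lt {q u : ℕ} (h : M.eRank < u) : Profile.ProfileIneq M q u := by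
  unfold Profile.ProfileIneq
  rw [Finset.sum_eq_zero (fun B _ => price_eq_zero_of_eRank_lt h B)]
  exact Nat.cast_nonneg _

/-- g6's price bound for a `q`-subset of the ground set: `price ≤ C(n, u)/C(n, q)` for every `u ≥ q`
(`Profile.choose_ratio_mono`: the ratio `C(m, u)/C(m, q)` is monotone in `m`, and `ρ(E ∖ B) + q ≤ n`). -/
theorem price_le_of_card {q u : ℕ} (hqu : q ≤ u) {B : Finset α} (hBg : B ⊆ gr M) (hBc : B.card = q) :
    Profile.price M q u B ≤ (Nat.choose (gr M).card u : ℚ) / (Nat.choose (gr M).card q : ℚ) := by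
  unfold Profile.price
  split_ifs with hu
  · set p' := (M.eRk ((gr M \ B : Finset α) : Set α)).toNat with hp'
    have hfin : M.eRk ((gr M \ B : Finset α) : Set α) ≠ ⊤ := by
      have := M.eRk_le_encard ((gr M \ B : Finset α) : Set α)
      rw [Set.encard_coe_eq_coe_finsetCard] at this
      exact ne_top_of_le_ne_top (ENat.coe_ne_top _) this
    have hp'le : p' ≤ (gr M \ B).card := by
      have := M.eRk_le_encard ((gr M \ B : Finset α) : Set α)
      rw [Set.encard_coe_eq_coe_finsetCard, ← ENat.coe_toNat hfin] at this
      exact_mod_cast this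
    have hcard : (gr M \ B).card = (gr M).card - q := by rw [Finset.card_sdiff_of_subset hBg, hBc]
    have hqn : q ≤ (gr M).card := hBc ▸ Finset.card_le_card hBg
    have hup' : u ≤ p' := by
      rw [← ENat.coe_toNat hfin] at hu
      exact_mod_cast hu
    exact Profile.choose_ratio_mono hqu (by omega) (by omega)
  · exact div_nonneg (Nat.cast_nonneg _) (Nat.cast_nonneg _)

/-- When every rank-`q` set is a `q`-subset of the ground set, the total price at the level `u ≥ q` is at most `C(n, u)`. -/
theorem sum_price_le_choose {q u : ℕ} (hqu : q ≤ u) (hRq : Profile.Rq M q ⊆ Finset.powersetCard q (gr M)) :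
    ∑ B ∈ Profile.Rq M q, Profile.price M q u B ≤ (Nat.choose (gr M).card u : ℚ) := by
  set n := (gr M).card with hn
  have hcard : (Profile.Rq M q).card ≤ Nat.choose n q := by
    rw [← Finset.card_powersetCard]
    exact Finset.card_le_card hRq
  calc ∑ B ∈ Profile.Rq M q, Profile.price M q u B
      ≤ ∑ _B ∈ Profile.Rq M q, (Nat.choose n u : ℚ) / (Nat.choose n q : ℚ) := by
        apply Finset.sum_le_sum
        intro B hB
        have hB' := hRq hB
        rw [Finset.mem_powersetCard] at hB'
        exact price_le_of_card hqu hB'.1 hB'.2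
    _ = ((Profile.Rq M q).card : ℚ) * ((Nat.choose n u : ℚ) / (Nat.choose n q : ℚ)) := by
        rw [Finset.sum_const, nsmul_eq_mul]
    _ ≤ (Nat.choose n q : ℚ) * ((Nat.choose n u : ℚ) / (Nat.choose n q : ℚ)) := by
        apply mul_le_mul_of_nonneg_right _ (div_nonneg (Nat.cast_nonneg _) (Nat.cast_nonneg _))
        exact_mod_cast hcard
    _ ≤ (Nat.choose n u : ℚ) := by
        by_cases hz : (Nat.choose n q : ℚ) = 0
        · rw [hz, zero_mul]; exact Nat.cast_nonneg _
        · rw [mul_div_cancel₀ _ hz]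

/-- A dependent `(v+1)`-subset of the ground set, every `v`-subset of which is independent, has rank exactly `v`. -/
theorem rkN_eq_of_dep_of_girth {v : ℕ} (hg : ∀ T ⊆ M.E, T.encard ≤ v → M.Indep T) {S : Finset α}
    (hSg : S ⊆ gr M) (hSc : S.card = v + 1) (hdep : ¬ M.Indep (S : Set α)) : rkN M S = v := by
  have h1 : rkN M S < S.card := ThinGirth.rkN_lt_card_of_not_indep hdep
  have hne : S.Nonempty := by rw [← Finset.card_pos]; omega
  obtain ⟨x, hx⟩ := hne
  have hTg : ((S.erase x : Finset α) : Set α) ⊆ M.E := by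
    rw [← coe_gr]; exact_mod_cast (Finset.erase_subset x S).trans hSg
  have hTc : (S.erase x).card = v := by rw [Finset.card_erase_of_mem hx, hSc]; omega
  have hTi : M.Indep ((S.erase x : Finset α) : Set α) :=
    hg _ hTg (by rw [Set.encard_coe_eq_coe_finsetCard, hTc])
  have h2 : rkN M (S.erase x) = v := by
    rw [Staged.rkN_eq_iff, hTi.eRk_eq_encard, Set.encard_coe_eq_coe_finsetCard, hTc]
  have h3 : rkN M (S.erase x) ≤ rkN M S := Staged.rkN_mono (Finset.erase_subset x S)
  omega

omit [DecidableEq α] in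
/-- A set of rank `v < ρ(E)` does not span: some point of the ground set lies outside its closure. -/
theorem exists_notMem_closure_of_rkN_eq {S : Finset α} {v : ℕ} (hS : rkN M S = v)
    (hrank : ((v + 1 : ℕ) : ℕ∞) ≤ M.eRank) : ∃ y ∈ gr M, y ∉ M.closure (S : Set α) := by
  by_contra hcon
  have hsub : M.E ⊆ M.closure (S : Set α) := by
    intro y hy
    by_contra hyc
    exact hcon ⟨y, ThinGirth.mem_gr_of_mem_ground hy, hyc⟩
  have h1 : M.eRank ≤ M.eRk (S : Set α) := by
    rw [Matroid.eRank_def, ← M.eRk_closure_eq (S : Set α)]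
    exact M.eRk_mono hsub
  rw [← Staged.coe_rkN, hS] at h1
  have h2 := hrank.trans h1
  have : v + 1 ≤ v := by exact_mod_cast h2
  omega

/-- Adding a point outside the closure raises the rank by one. -/
theorem rkN_insert_of_notMem_closure {S : Finset α} {y : α} (hy : y ∈ gr M) (hyc : y ∉ M.closure (S : Set α)) :
    rkN M (insert y S) = rkN M S + 1 := by
  have hyE : y ∈ M.E := by rw [← coe_gr]; exact_mod_cast hy
  rw [Staged.rkN_eq_iff, Finset.coe_insert, Matroid.eRk_insert_eq_add_one ⟨hyE, hyc⟩, ← Staged.coe_rkN]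
  norm_cast

/-- **The injectivity**: two `(v+1)`-subsets `S, S'` of rank `v` whose `v`-subsets are independent, extended by points
`y ∉ S`, `y' ∉ S'` to the same `(v+2)`-set `T` of rank `v + 1`, coincide — otherwise `S ∩ S'` is an independent `v`-set
and submodularity gives `v + (v + 1) = ρ(S ∩ S') + ρ(S ∪ S') ≤ ρ(S) + ρ(S') = 2v`. -/
theorem eq_of_insert_eq_of_girth {v : ℕ} (hg : ∀ T ⊆ M.E, T.encard ≤ v → M.Indep T)
    {S S' : Finset α} (hSg : S ⊆ gr M) (hSc : S.card = v + 1) (hS'c : S'.card = v + 1)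
    (hS : rkN M S = v) (hS' : rkN M S' = v) {y y' : α} (hyS : y ∉ S) (hy'S' : y' ∉ S')
    (hT : rkN M (insert y S) = v + 1) (heq : insert y S = insert y' S') : S = S' := by
  have hy_mem : y ∈ insert y' S' := heq ▸ Finset.mem_insert_self y S
  rcases Finset.mem_insert.1 hy_mem with hyy | hyS'
  · subst hyy
    rw [← Finset.erase_insert hyS, ← Finset.erase_insert hy'S', heq]
  · exfalso
    have hU : S ∪ S' = insert y S := by
      apply subset_antisymm
      · apply Finset.union_subset (Finset.subset_insert y S)
        rw [heq]
        exact Finset.subset_insert y' S'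
      · intro z hz
        rcases Finset.mem_insert.1 hz with rfl | hzS
        · exact Finset.mem_union_right _ hyS'
        · exact Finset.mem_union_left _ hzS
    have hUc : (S ∪ S').card = v + 2 := by rw [hU, Finset.card_insert_of_notMem hyS, hSc]
    have hIc : (S ∩ S').card = v := by
      have := Finset.card_union_add_card_inter S S'
      omega
    have hIg : ((S ∩ S' : Finset α) : Set α) ⊆ M.E := by
      rw [← coe_gr]; exact_mod_cast (Finset.inter_subset_left).trans hSg
    have hIi : M.Indep ((S ∩ S' : Finset α) : Set α) :=
      hg _ hIg (by rw [Set.encard_coe_eq_coe_finsetCard, hIc])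
    have hI : rkN M (S ∩ S') = v := by
      rw [Staged.rkN_eq_iff, hIi.eRk_eq_encard, Set.encard_coe_eq_coe_finsetCard, hIc]
    have hUr : rkN M (S ∪ S') = v + 1 := by rw [hU]; exact hT
    have hsub := ThinTriangle.rkN_inter_add_union_le (M := M) S S'
    omega

/-- **The level count at girth `≥ v + 1`**: if every set of at most `v` points is independent and `ρ(E) ≥ v + 1`, then
`C(n, v+1) ≤ #{S ⊆ E : ρ(S) = v + 1}` — the independent `(v+1)`-subsets lie in the level, and the dependent ones
(`(v+1)`-circuits, rank `v`) inject into the `(v+2)`-subsets of rank `v + 1` by `C ↦ C ∪ {y_C}`, `y_C ∉ cl(C)`. -/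
theorem choose_le_card_levelSet_of_girth {v : ℕ} (hg : ∀ T ⊆ M.E, T.encard ≤ v → M.Indep T)
    (hrank : ((v + 1 : ℕ) : ℕ∞) ≤ M.eRank) :
    Nat.choose (gr M).card (v + 1) ≤ (Shadow.levelSet M (v + 1)).card := by
  classical
  set P := Finset.powersetCard (v + 1) (gr M) with hP
  set I := P.filter (fun S : Finset α => M.Indep (S : Set α)) with hI
  set D := P.filter (fun S : Finset α => ¬ M.Indep (S : Set α)) with hD
  have hID : I.card + D.card = P.card := by
    rw [hI, hD]
    exact Finset.card_filter_add_card_filter_not _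
  have hDmem : ∀ S ∈ D, S ⊆ gr M ∧ S.card = v + 1 ∧ ¬ M.Indep (S : Set α) := by
    intro S hS
    rw [hD, Finset.mem_filter, hP, Finset.mem_powersetCard] at hS
    exact ⟨hS.1.1, hS.1.2, hS.2⟩
  have hDrk : ∀ S ∈ D, rkN M S = v := by
    intro S hS
    obtain ⟨h1, h2, h3⟩ := hDmem S hS
    exact rkN_eq_of_dep_of_girth hg h1 h2 h3
  have hex : ∀ S ∈ D, ∃ y ∈ gr M, y ∉ M.closure (S : Set α) := by
    intro S hS
    exact exists_notMem_closure_of_rkN_eq (hDrk S hS) hrank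
  let g : Finset α → Finset α := fun S =>
    if h : ∃ y ∈ gr M, y ∉ M.closure (S : Set α) then insert h.choose S else S
  have hgS : ∀ S ∈ D, ∃ y, y ∈ gr M ∧ y ∉ M.closure (S : Set α) ∧ y ∉ S ∧ g S = insert y S := by
    intro S hS
    have h := hex S hS
    refine ⟨h.choose, h.choose_spec.1, h.choose_spec.2, ?_, dif_pos h⟩
    intro hyS
    apply h.choose_spec.2
    have hSE : (S : Set α) ⊆ M.E := by rw [← coe_gr]; exact_mod_cast (hDmem S hS).1
    exact M.subset_closure (S : Set α) hSE (Finset.mem_coe.2 hyS)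
  have hgD : ∀ S ∈ D, g S ∈ Shadow.levelSet M (v + 1) ∧ (g S).card = v + 2 := by
    intro S hS
    obtain ⟨y, hyg, hyc, hyS, hgy⟩ := hgS S hS
    obtain ⟨hSg, hSc, _⟩ := hDmem S hS
    rw [hgy]
    refine ⟨?_, by rw [Finset.card_insert_of_notMem hyS, hSc]⟩
    rw [Profile.mem_levelSet]
    refine ⟨Finset.insert_subset hyg hSg, ?_⟩
    rw [← Staged.coe_rkN, rkN_insert_of_notMem_closure hyg hyc, hDrk S hS]
  have hinj : Set.InjOn g (D : Set (Finset α)) := by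
    intro S hS S' hS' hSS'
    obtain ⟨y, hyg, hyc, hyS, hgy⟩ := hgS S hS
    obtain ⟨y', _, _, hy'S', hgy'⟩ := hgS S' hS'
    rw [hgy, hgy'] at hSS'
    obtain ⟨hSg, hSc, _⟩ := hDmem S hS
    obtain ⟨_, hS'c, _⟩ := hDmem S' hS'
    have hT : rkN M (insert y S) = v + 1 := by
      rw [rkN_insert_of_notMem_closure hyg hyc, hDrk S hS]
    exact eq_of_insert_eq_of_girth hg hSg hSc hS'c (hDrk S hS) (hDrk S' hS') hyS hy'S' hT hSS'
  have hI_sub : I ⊆ Shadow.levelSet M (v + 1) := by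
    intro S hS
    rw [hI, Finset.mem_filter, hP, Finset.mem_powersetCard] at hS
    rw [Profile.mem_levelSet]
    refine ⟨hS.1.1, ?_⟩
    rw [hS.2.eRk_eq_encard, Set.encard_coe_eq_coe_finsetCard, hS.1.2]
  have himg : D.image g ⊆ Shadow.levelSet M (v + 1) := by
    rw [Finset.image_subset_iff]
    intro S hS
    exact (hgD S hS).1
  have hdisj : Disjoint I (D.image g) := by
    rw [Finset.disjoint_left]
    intro S hSI hSim
    rw [hI, Finset.mem_filter, hP, Finset.mem_powersetCard] at hSI
    rw [Finset.mem_image] at hSim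
    obtain ⟨S', hS', hS'S⟩ := hSim
    have := (hgD S' hS').2
    rw [hS'S] at this
    omega
  calc Nat.choose (gr M).card (v + 1) = P.card := (Finset.card_powersetCard _ _).symm
    _ = I.card + D.card := hID.symm
    _ = I.card + (D.image g).card := by rw [Finset.card_image_of_injOn hinj]
    _ = (I ∪ D.image g).card := (Finset.card_union_of_disjoint hdisj).symm
    _ ≤ (Shadow.levelSet M (v + 1)).card := Finset.card_le_card (Finset.union_subset hI_sub himg)

/-- **THE ROW `(q, v + 1)` OF THE PROFILE INEQUALITY AT GIRTH `≥ v + 1`**: if every set of at most `v` points is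
independent and `q + 1 ≤ v`, then `Σ_{B : ρ(B) = q, ρ(E∖B) ≥ v+1} C(ρ(E∖B)+q, v+1)/C(ρ(E∖B)+q, q) ≤ #{S : ρ(S) = v + 1}`
(g6's `profileIneq_of_girth` needs every set of at most `v + 1` points independent). -/
theorem profileIneq_of_girth_succ {q v : ℕ} (hg : ∀ T ⊆ M.E, T.encard ≤ v → M.Indep T) (hqv : q + 1 ≤ v) :
    Profile.ProfileIneq M q (v + 1) := by
  rcases lt_or_ge M.eRank ((v + 1 : ℕ) : ℕ∞) with hlt | hge
  · exact profileIneq_of_eRank_lt hlt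
  · unfold Profile.ProfileIneq
    have hRq : Profile.Rq M q ⊆ Finset.powersetCard q (gr M) := Rq_subset_powersetCard hg (by omega)
    calc ∑ B ∈ Profile.Rq M q, Profile.price M q (v + 1) B
        ≤ (Nat.choose (gr M).card (v + 1) : ℚ) := sum_price_le_choose (by omega) hRq
      _ ≤ ((Shadow.levelSet M (v + 1)).card : ℚ) := by
          exact_mod_cast choose_le_card_levelSet_of_girth hg hge

/-- The same with the girth hypothesis on finsets of the ground set (`rkN`): every `X ⊆ gr M` with at most `v` points
has full rank. -/
theorem profileIneq_of_girth_succ' {q v : ℕ} (hg : ∀ X ⊆ gr M, X.card ≤ v → rkN M X = X.card) (hqv : q + 1 ≤ v) :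
    Profile.ProfileIneq M q (v + 1) := by
  apply profileIneq_of_girth_succ _ hqv
  intro T hTE hTc
  have hfin : T.Finite := M.ground_finite.subset hTE
  have hTc' : hfin.toFinset.card ≤ v := by
    have : (hfin.toFinset : Set α).encard = T.encard := by rw [Set.Finite.coe_toFinset]
    rw [← this, Set.encard_coe_eq_coe_finsetCard] at hTc
    exact_mod_cast hTc
  have hTg : hfin.toFinset ⊆ gr M := by
    intro x hx
    rw [Set.Finite.mem_toFinset] at hx
    exact ThinGirth.mem_gr_of_mem_ground (hTE hx)
  have h := hg _ hTg hTc'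
  rw [Matroid.indep_iff_eRk_eq_encard_of_finite hfin]
  rw [Staged.rkN_eq_iff] at h
  rw [Set.Finite.coe_toFinset] at h
  rw [h, ← Set.encard_coe_eq_coe_finsetCard, Set.Finite.coe_toFinset]

/-- **The pointwise bridge at every `p`**: the rows `(q, u)`, `q < u < p`, of the profile inequality give C-025 at
`(p, q)` for `M` (the proof of g6's `c025_of_profile`, for one matroid). -/
theorem rls_of_profileIneq_rows (p q : ℕ)
    (h : ∀ u, q < u → u < p → Profile.ProfileIneq M q u) : ThmN.RLS M p q := by
  unfold ThmN.RLS
  rw [PerFlat.ncard_Y_eq_card_Yq]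
  have hY : ((PerFlat.Yq M p q).card : ℚ) = ∑ u ∈ Finset.Ioo q p, ((Shadow.levelSet M u).card : ℚ) := by
    exact_mod_cast Profile.card_Yq_eq_sum (M := M) p q
  calc phiK p q * ({A : Set α | A ⊆ M.E ∧ M.eRk A = (p : ℕ∞) ∧ M.eRk (M.E \ A) = (q : ℕ∞)}.ncard : ℚ)
      ≤ phiK p q * ((PerFlat.Uq M p q).card : ℚ) := by
        apply mul_le_mul_of_nonneg_left _ (Profile.phiK_nonneg p q)
        exact_mod_cast PerFlat.ncard_U_le_card_Uq M p q
    _ = ∑ u ∈ Finset.Ioo q p,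
          ((PerFlat.Uq M p q).card : ℚ) * ((Nat.choose (p + q) u : ℚ) / (Nat.choose (p + q) q : ℚ)) := by
        rw [Profile.phiK_eq_sum_levels, Finset.sum_mul]
        apply Finset.sum_congr rfl
        intro u _
        ring
    _ ≤ ∑ u ∈ Finset.Ioo q p, ((Shadow.levelSet M u).card : ℚ) := by
        apply Finset.sum_le_sum
        intro u hu
        rw [Finset.mem_Ioo] at hu
        exact Profile.card_Uq_mul_le_card_Lq hu.2.le (h u hu.1 hu.2)
    _ = ((PerFlat.Yq M p q).card : ℚ) := hY.symm

/-- **C-025 AT `(v + 2, q)` AT GIRTH `≥ v + 1`**: if every set of at most `v` points is independent and `q + 1 ≤ v`, then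
`ThmN.RLS M (v + 2) q` — the rows `(q, u)` with `u ≤ v` by g6's `profileIneq_of_girth`, the row `(q, v + 1)` by
`profileIneq_of_girth_succ`. -/
theorem rls_of_girth' {q v : ℕ} (hg : ∀ T ⊆ M.E, T.encard ≤ v → M.Indep T) (hqv : q + 1 ≤ v) :
    ThmN.RLS M (v + 2) q := by
  apply rls_of_profileIneq_rows
  intro u hqu hup
  rcases Nat.lt_or_ge u (v + 1) with hu | hu
  · have hg' : ∀ T ⊆ M.E, T.encard ≤ u → M.Indep T := by
      intro T hT hTc
      exact hg T hT (hTc.trans (by exact_mod_cast (by omega : u ≤ v)))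
    exact profileIneq_of_girth hg' hqu
  · have hu' : u = v + 1 := by omega
    rw [hu']
    exact profileIneq_of_girth_succ hg hqv

/-- **C-025 AT `(p, q)` ON EVERY MATROID OF GIRTH `≥ p − 1`**, `p ≥ q + 3`: if every set with at most `p − 2` points is
independent, then `ThmN.RLS M p q`. -/
theorem rls_of_girth (p q : ℕ) (hpq : q + 3 ≤ p) (hg : ∀ T ⊆ M.E, T.encard + 2 ≤ p → M.Indep T) :
    ThmN.RLS M p q := by
  have hp : p = (p - 2) + 2 := by omega
  have hg' : ∀ T ⊆ M.E, T.encard ≤ ((p - 2 : ℕ) : ℕ∞) → M.Indep T := by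
    intro T hT hTc
    apply hg T hT
    have h2 : ((p - 2 : ℕ) : ℕ∞) + 2 = (p : ℕ∞) := by
      norm_cast
      omega
    calc T.encard + 2 ≤ ((p - 2 : ℕ) : ℕ∞) + 2 := by gcongr
      _ = (p : ℕ∞) := h2
  rw [hp]
  exact rls_of_girth' hg' (by omega)

end GirthRows

end PercRepro
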